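import Literature.Topology.FourManifolds.GroupTrisections
import Summits.SmoothPoincare4.SmoothPoincare4.Theorems.CongruenceShadowsShadowsStandardStubFaceCharOfTrisection
import Mathlib.GroupTheory.QuotientGroup.Basic
import Mathlib.Tactic.FinCases
import HarnessLib

/-!
# Stub `stub_trisectionPairPrimitives_zero` of line `finitary-ac-central-residue` for crux
`CongruenceShadows.ShadowsStandard` (item stmt-SmoothPoincare4-14593, route
route-SmoothPoincare4-CongruenceShadows)

**Two primitives in the kernel — the trisection pair `(N 0, K 2)`, genus `3`.** With
`S = SurfaceGroup 3` and `N = s4Kernels` the standard genus-`3` trisection of `S⁴`, let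
`K = (N 0, N 1, K 2)` be a `(3;1)` group trisection of the trivial group normalised in its first
two slots. Then the free group `S ⧸ K 2 ≅ F₃` has a free basis two of whose members lie in the
image of `N 0`.

Proof.
* The tree theorem `stub_faceCharOfTrisection` supplies the face character
  `f : S →* ℤ` with `ker f = K 2 ⊔ N 0`; it descends to `f̄ : S ⧸ K 2 →* ℤ`, and the image of
  `N 0` in `S ⧸ K 2` is exactly `ker f̄` (`(K 2 ⊔ N 0).map mk = N 0 .map mk`).
* `free_quotient 2` gives `e₀ : F₃ = FreeGroup (Fin 3) ≃* S ⧸ K 2`; put `g = f̄ ∘ e₀ : F₃ →* ℤ`.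
* **Euclid on `Hom(F₃, ℤ)`**: for every `g : F₃ →* ℤ` there is `θ ∈ Aut F₃` with
  `g (θ x₁) = g (θ x₂) = 0` — the Euclidean algorithm on the value vector
  `(g x₀, g x₁, g x₂) ∈ ℤ³`, realised by the transvections `xᵢ ↦ xᵢ xⱼ^e` (which act on value
  vectors by `vᵢ ↦ vᵢ + e vⱼ`) and permutations of the generators, strictly decreasing
  `∑ |vᵢ|` until at most one coordinate is nonzero, which a permutation moves to slot `0`.
* The basis `e = e₀ ∘ θ` with the two members `e x₁, e x₂ ∈ ker f̄ = N 0 .map mk`.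

The file declares theorems only (automorphisms are produced by existence lemmas).
-/

-- the prescribed namespace `Summit.<P>.<Sub>.…` duplicates `SmoothPoincare4` (P = Sub)
set_option linter.dupNamespace false

noncomputable section

namespace Summit.SmoothPoincare4.SmoothPoincare4.Theorems.ShadowsStandard.FinitaryAcCentralResidue

open Literature.Topology.FourManifolds
open Subgroup
open _root_.Summit.SmoothPoincare4.SmoothPoincare4.Theorems.ShadowsStandard.PowerTwistAbsorption
  (stub_faceCharOfTrisection)

/-! ## Elementary automorphisms of a free group -/

/-- **Transvections.** For generators `i ≠ j` of a free group and `e : ℤ` there is an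
automorphism `xᵢ ↦ xᵢ xⱼ^e` fixing the other generators (its inverse is `xᵢ ↦ xᵢ xⱼ^{-e}`). -/
theorem exists_transvection {α : Type*} [DecidableEq α] (i j : α) (hij : i ≠ j) (e : ℤ) :
    ∃ T : FreeGroup α ≃* FreeGroup α,
      T (FreeGroup.of i) = FreeGroup.of i * FreeGroup.of j ^ e ∧
      ∀ k, k ≠ i → T (FreeGroup.of k) = FreeGroup.of k := by
  refine ⟨MonoidHom.toMulEquiv
      (FreeGroup.lift fun k =>
        if k = i then FreeGroup.of i * FreeGroup.of j ^ e else FreeGroup.of k)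
      (FreeGroup.lift fun k =>
        if k = i then FreeGroup.of i * FreeGroup.of j ^ (-e) else FreeGroup.of k)
      ?_ ?_, ?_, ?_⟩
  · refine FreeGroup.ext_hom _ _ fun k => ?_
    by_cases hk : k = i
    · subst hk
      simp [hij.symm, mul_assoc]
    · simp [hk]
  · refine FreeGroup.ext_hom _ _ fun k => ?_
    by_cases hk : k = i
    · subst hk
      simp [hij.symm, mul_assoc]
    · simp [hk]
  · simp
  · intro k hk
    simp [hk]

/-! ## The Euclidean algorithm on `ℤ³` -/

/-- **Euclidean descent on value vectors.** A property of vectors `v : Fin 3 → ℤ` that holds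
when `v 1 = v 2 = 0`, descends along permutations of the coordinates and descends along the
elementary moves `vᵢ ↦ vᵢ + e vⱼ` (`i ≠ j`) holds everywhere: by induction on `∑ |vᵢ|`, either
two coordinates are nonzero and an elementary move with `e = ±1` lowers the measure, or at most
one is and a transposition moves it to slot `0`. -/
theorem euclid_fin_three (P : (Fin 3 → ℤ) → Prop)
    (h1 : ∀ v, v 1 = 0 → v 2 = 0 → P v)
    (hperm : ∀ v (σ : Equiv.Perm (Fin 3)), P (v ∘ σ) → P v)
    (hadd : ∀ v (i j : Fin 3) (e : ℤ), i ≠ j → P (Function.update v i (v i + e * v j)) → P v) :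
    ∀ v, P v := by
  -- the measure after an elementary move
  have hmeas : ∀ (w : Fin 3 → ℤ) (i : Fin 3) (b : ℤ),
      (Function.update w i b 0).natAbs + (Function.update w i b 1).natAbs +
          (Function.update w i b 2).natAbs + (w i).natAbs =
        b.natAbs + ((w 0).natAbs + (w 1).natAbs + (w 2).natAbs) := by
    intro w i b
    fin_cases i <;> simp <;> omega
  suffices H : ∀ (n : ℕ) (v : Fin 3 → ℤ),
      (v 0).natAbs + (v 1).natAbs + (v 2).natAbs ≤ n → P v from fun v => H _ v le_rfl
  intro n
  induction n with
  | zero =>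
    intro v hv
    exact h1 v (by omega) (by omega)
  | succ n ih =>
    intro v hv
    by_cases H : ∃ i j : Fin 3, i ≠ j ∧ v j ≠ 0 ∧ (v j).natAbs ≤ (v i).natAbs
    · -- two nonzero coordinates: an elementary move lowers the measure
      obtain ⟨i, j, hij, hj, hle⟩ := H
      obtain ⟨e, he⟩ : ∃ e : ℤ, (v i + e * v j).natAbs + (v j).natAbs = (v i).natAbs := by
        rcases le_or_gt 0 (v i) with hi | hi <;> rcases le_or_gt 0 (v j) with hj' | hj'
        · exact ⟨-1, by omega⟩
        · exact ⟨1, by omega⟩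
        · exact ⟨1, by omega⟩
        · exact ⟨-1, by omega⟩
      refine hadd v i j e hij (ih _ ?_)
      have hm := hmeas v i (v i + e * v j)
      omega
    · -- at most one nonzero coordinate: move it to slot `0`
      push Not at H
      have hz : ∀ i j : Fin 3, i ≠ j → v i = 0 ∨ v j = 0 := by
        intro i j hij
        by_contra hc
        push Not at hc
        have h₁ := H i j hij hc.2
        have h₂ := H j i hij.symm hc.1
        omega
      by_cases hv1 : v 1 = 0
      · by_cases hv2 : v 2 = 0
        · exact h1 v hv1 hv2
        · have hv0 : v 0 = 0 := (hz 0 2 (by decide)).resolve_right hv2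
          exact hperm v (Equiv.swap 0 2)
            (h1 _ (by simpa [Equiv.swap_apply_of_ne_of_ne] using hv1) (by simpa using hv0))
      · have hv0 : v 0 = 0 := (hz 0 1 (by decide)).resolve_right hv1
        have hv2 : v 2 = 0 := (hz 1 2 (by decide)).resolve_left hv1
        exact hperm v (Equiv.swap 0 1)
          (h1 _ (by simpa using hv0) (by simpa [Equiv.swap_apply_of_ne_of_ne] using hv2))

/-! ## Euclid on `Hom(F₃, ℤ)` -/

/-- **Euclid on `Hom(F₃, ℤ)`.** For every homomorphism `g : F₃ →* ℤ` there is an automorphism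
`θ` of `F₃ = FreeGroup (Fin 3)` with `g (θ x₁) = g (θ x₂) = 0` (written multiplicatively): run
`euclid_fin_three` on the value vector `k ↦ g xₖ`, realising coordinate permutations by
`FreeGroup.freeGroupCongr` and elementary moves by transvections (`exists_transvection`). -/
theorem exists_mulEquiv_map_of_eq_one (g : FreeGroup (Fin 3) →* Multiplicative ℤ) :
    ∃ θ : FreeGroup (Fin 3) ≃* FreeGroup (Fin 3),
      g (θ (FreeGroup.of 1)) = 1 ∧ g (θ (FreeGroup.of 2)) = 1 := by
  suffices H : ∀ (v : Fin 3 → ℤ) (g : FreeGroup (Fin 3) →* Multiplicative ℤ),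
      (∀ k, (g (FreeGroup.of k)).toAdd = v k) →
      ∃ θ : FreeGroup (Fin 3) ≃* FreeGroup (Fin 3),
        g (θ (FreeGroup.of 1)) = 1 ∧ g (θ (FreeGroup.of 2)) = 1 from
    H _ g fun k => rfl
  refine euclid_fin_three _ ?_ ?_ ?_
  · intro v hv1 hv2 g hg
    refine ⟨MulEquiv.refl _, ?_, ?_⟩
    · rw [MulEquiv.refl_apply, ← ofAdd_toAdd (g (FreeGroup.of 1)), hg 1, hv1, ofAdd_zero]
    · rw [MulEquiv.refl_apply, ← ofAdd_toAdd (g (FreeGroup.of 2)), hg 2, hv2, ofAdd_zero]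
  · intro v σ ih g hg
    obtain ⟨θ, hθ1, hθ2⟩ := ih (g.comp (FreeGroup.freeGroupCongr σ).toMonoidHom) fun k => by
      simp [FreeGroup.map.of, hg]
    exact ⟨θ.trans (FreeGroup.freeGroupCongr σ), hθ1, hθ2⟩
  · intro v i j e hij ih g hg
    obtain ⟨T, hTi, hTk⟩ := exists_transvection i j hij e
    obtain ⟨θ, hθ1, hθ2⟩ := ih (g.comp T.toMonoidHom) fun k => by
      by_cases hk : k = i
      · subst hk
        simp [hTi, hg, toAdd_zpow]
      · simp [hTk k hk, hg, hk]
    exact ⟨θ.trans T, hθ1, hθ2⟩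

/-! ## The stub -/

/-- **Stub `stub_trisectionPairPrimitives_zero`.** For a `(3;1)` group trisection `K` of the
trivial group with `K 0 = N 0` and `K 1 = N 1` (`N = s4Kernels`), the free group
`S ⧸ K 2 ≅ F₃` has a free basis two of whose (distinct) members lie in the image of `N 0`:
the image of `N 0` is the kernel of the descended face character `f̄ : S ⧸ K 2 →* ℤ`
(`stub_faceCharOfTrisection`: `ker f = K 2 ⊔ N 0`), and Euclid on `Hom(F₃, ℤ)`
(`exists_mulEquiv_map_of_eq_one`) re-bases `F₃ ≅ S ⧸ K 2` so that two basis elements die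
under `f̄`. -/
theorem stub_trisectionPairPrimitives_zero :
    ∀ (K : TrisectionKernels 3) [(K 2).Normal], IsGroupTrisection 3 1 (PUnit : Type) K →
      K 0 = s4Kernels 0 → K 1 = s4Kernels 1 →
      ∃ (ι : Type) (_ : Fintype ι) (_ : DecidableEq ι) (e : FreeGroup ι ≃* SurfaceGroup 3 ⧸ K 2)
        (a b : ι), a ≠ b ∧
        e (FreeGroup.of a) ∈ (s4Kernels 0).map (QuotientGroup.mk' (K 2)) ∧
        e (FreeGroup.of b) ∈ (s4Kernels 0).map (QuotientGroup.mk' (K 2)) := by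
  intro K _ hK h0 h1
  obtain ⟨f, -, -, -, -, -, hker⟩ := stub_faceCharOfTrisection K hK h0 h1
  -- `F₃ ≅ S ⧸ K 2`
  obtain ⟨e₀'⟩ := hK.free_quotient 2
  obtain ⟨e₀⟩ : Nonempty (FreeGroup (Fin 3) ≃* SurfaceGroup 3 ⧸ K 2) :=
    ⟨e₀'.trans (QuotientGroup.quotientMulEquivOfEq (normalClosure_eq_self (K 2)))⟩
  -- the descended face character kills exactly the image of `N 0`
  have hle : K 2 ≤ f.ker := by
    rw [hker]
    exact le_sup_left
  have hmem : ∀ x : FreeGroup (Fin 3),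
      ((QuotientGroup.lift (K 2) f hle).comp e₀.toMonoidHom) x = 1 →
        e₀ x ∈ (s4Kernels 0).map (QuotientGroup.mk' (K 2)) := by
    intro x hx
    rw [MonoidHom.comp_apply, MulEquiv.coe_toMonoidHom] at hx
    obtain ⟨s, hs⟩ := QuotientGroup.mk_surjective (e₀ x)
    rw [← hs, QuotientGroup.lift_mk] at hx
    have h := mem_map_of_mem (QuotientGroup.mk' (K 2)) (show s ∈ f.ker from hx)
    rw [hker, Subgroup.map_sup, (map_eq_bot_iff (K 2)).2 (QuotientGroup.ker_mk' (K 2)).ge,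
      bot_sup_eq] at h
    rw [← hs]
    exact h
  -- Euclid
  obtain ⟨θ, hθ1, hθ2⟩ :=
    exists_mulEquiv_map_of_eq_one ((QuotientGroup.lift (K 2) f hle).comp e₀.toMonoidHom)
  exact ⟨Fin 3, inferInstance, inferInstance, θ.trans e₀, 1, 2, by decide, hmem _ hθ1, hmem _ hθ2⟩

end Summit.SmoothPoincare4.SmoothPoincare4.Theorems.ShadowsStandard.FinitaryAcCentralResidue

end
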